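import Mathlib
import Literature.NumberTheory.Transcendental.BrumerPadicBaker
import Literature.NumberTheory.Transcendental.BrumerPadicConclusion
import HarnessLib

/-!
# Brumer's `p`-adic analogue of Baker's theorem — proof of `brumer1967_thm1`

Topic `Literature/NumberTheory/Transcendental`; namespace `Literature.NumberTheory.Transcendental`.
This sibling file DISCHARGES the named fact `brumer1967_thm1` of `BrumerPadicBaker.lean`
(A. Brumer, *On the units of algebraic number fields*, Mathematika **14** (1967) 121–124,
**Theorem 1**, the `p`-adic analogue of Baker's theorem; homogeneous form for algebraic
principal units of `ℚ̄_p`): `theorem brumer1967_thm1_holds : brumer1967_thm1 p`, sorry-free, with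
no new definitions and no new named facts.

## The proof

Brumer proves Theorem 1 "by the method of Baker" (A. Baker, *Linear forms in the logarithms of
algebraic numbers*, Mathematika 1966–67; book form: *Transcendental Number Theory*, 1975, Ch. 2)
in the `p`-adic domain.  The tree holds a sorry-free formalisation of Baker's Ch. 2 over `ℂ`
(`BakerLogarithms*.lean`); the files `BrumerPadicAnalytic`, `BrumerPadicSetup`,
`BrumerPadicField`, `BrumerPadicConclusion` port it to a complete ultrametric normed
`ℚ_p`-algebra field (Schwarz's lemma with multiplicities in place of the maximum modulus
principle, the Liouville inequality at a `p`-adic place in place of the norm inequality, and — the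
relation being homogeneous — a Vandermonde determinant in place of Lemmas 5–7), ending in
`BrumerPadic.Setup.false_of_setup`: no normalised counterexample (`BrumerPadic.Setup`) exists.

This file performs the reduction of the fact to a `Setup` over `ℂ_p = PadicComplex p`
(Baker 1975, Ch. 2 §3: "we may suppose (1) … with `βₙ = -1`", `p`-adically):

* a `ℚ̄`-linear dependence among the `log_p αᵢ` is a finite relation `∑_{i ∈ t} gᵢ log_p αᵢ = 0`
  with all `gᵢ ≠ 0`; map it to `ℂ_p` (isometric embedding `ℚ̄_p → ℂ_p`);
* replace `αᵢ` by `yᵢ = αᵢ^{p^κ}` with `κ` so large that every `yᵢ` is `exp cᵢ` with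
  `‖cᵢ‖ < p⁻²` (local surjectivity of the `p`-adic exponential, `PadicExp.exists_forall_exists_exp_eq`,
  and `αᵢ^{p^k} → 1`); then `cᵢ = L(exp cᵢ) = L(yᵢ) = p^κ log_p αᵢ` (`BrumerPadic.logSeries_exp`,
  `IwasawaLog.logSeries_pow`), so the `ℓᵢ = cᵢ/p` are a non-zero common multiple of the
  `log_p αᵢ`: still linearly independent over `ℚ`, of norm `< p⁻¹`, with `exp (p ℓᵢ) = yᵢ`
  algebraic;
* divide the relation by a coefficient `g_{i₀}` of maximal absolute value: the `βᵢ = -gᵢ/g_{i₀}`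
  are algebraic of norm `≤ 1` and `ℓ_{i₀} = ∑_{i ≠ i₀} βᵢ ℓᵢ` — a `Setup`, which is absurd.

## References

* [Brumer1967] A. Brumer, *On the units of algebraic number fields*, Mathematika 14 (1967),
  121–124, Theorem 1.
* [BakerTNT1975] A. Baker, *Transcendental Number Theory*, CUP 1975, Ch. 2 (Theorem 2.1 and its
  proof, pp. 19–27).
* [Roy1992] D. Roy, J. Number Theory 41 (1992), pp. 22, 24 (the statement as vendored).
-/

noncomputable section

open NormedSpace Filter Finset
open _root_.Topology

namespace Literature.NumberTheory.Transcendental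

namespace BrumerPadic

variable {p : ℕ} [Fact p.Prime]

/-- `Fin.snoc f a` is injective when `f` is injective and avoids `a`. [folklore] -/
theorem snoc_injective {ι : Type*} {n : ℕ} {f : Fin n → ι} (hf : Function.Injective f) {a : ι}
    (ha : ∀ r, f r ≠ a) : Function.Injective (Fin.snoc f a : Fin (n + 1) → ι) := by
  intro x y hxy
  cases x using Fin.lastCases with
  | last =>
    cases y using Fin.lastCases with
    | last => rfl
    | cast s =>
      simp only [Fin.snoc_last, Fin.snoc_castSucc] at hxy
      exact absurd hxy.symm (ha s)
  | cast r =>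
    cases y using Fin.lastCases with
    | last =>
      simp only [Fin.snoc_last, Fin.snoc_castSucc] at hxy
      exact absurd hxy (ha r)
    | cast s =>
      simp only [Fin.snoc_castSucc] at hxy
      rw [hf hxy]

/-- Powers `y^{p^k}` of a principal unit of a complete normed `ℚ_p`-algebra field tend to `1`
(from the limit formula `(y^{p^k} − 1)/p^k → L(y)`). [folklore] -/
theorem tendsto_pow_prime_pow_sub_one {E : Type*} [NormedField E] [NormedAlgebra ℚ_[p] E]
    [CompleteSpace E] {y : E} (hy : ‖1 - y‖ < 1) :
    Tendsto (fun k : ℕ => y ^ (p ^ k) - 1) atTop (𝓝 0) := by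
  have h1 := IwasawaLog.tendsto_pow_prime_pow_sub_one_div (p := p) y hy
  have h2 := h1.mul (IwasawaLog.tendsto_prime_pow_zero (p := p) (F := E))
  rw [mul_zero] at h2
  refine h2.congr fun k => ?_
  have hP : (p : E) ^ k ≠ 0 := by
    refine pow_ne_zero k fun h0 => ?_
    have h1 : ‖(p : E)‖ = ‖(p : ℚ_[p])‖ := IwasawaLog.norm_natCast p (F := E) p
    rw [h0, norm_zero, Padic.norm_p] at h1
    exact (inv_pos.mpr (by exact_mod_cast (Fact.out : p.Prime).pos)).ne' h1.symm
  rw [div_mul_cancel₀ _ hP]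

end BrumerPadic

open BrumerPadic

variable (p : ℕ) [Fact p.Prime]

/-- **Discharge of `brumer1967_thm1` — Brumer 1967, Theorem 1, the `p`-adic analogue of Baker's
theorem** (homogeneous form, principal units): for `αᵢ ∈ ℚ̄_p` algebraic over `ℚ` with
`|αᵢ − 1|_p < 1`, if the `log_p αᵢ` are linearly independent over `ℚ` then they are linearly
independent over `ℚ̄ ⊂ ℚ̄_p`.  Proof: Baker's method `p`-adically (files `BrumerPadic*.lean`,
`BrumerPadic.Setup.false_of_setup`), after the reduction described in the module docstring.
[cite: Brumer1967, Theorem 1] [cite: BakerTNT1975, Ch. 2, Theorem 2.1] -/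
theorem brumer1967_thm1_holds : brumer1967_thm1 p := by
  classical
  intro ι α halg h1 hli
  by_contra hdep
  have hp : p.Prime := Fact.out
  have hp0r : (0 : ℝ) < p := by exact_mod_cast hp.pos
  -- a finite non-trivial relation with all coefficients non-zero
  obtain ⟨s, g, hrel, i₁, hi₁s, hgi₁⟩ := not_linearIndependent_iff.mp hdep
  set t : Finset ι := s.filter fun i => g i ≠ 0 with ht
  have hi₁t : i₁ ∈ t := Finset.mem_filter.mpr ⟨hi₁s, hgi₁⟩
  have htne : t.Nonempty := ⟨i₁, hi₁t⟩
  have hgt : ∀ i ∈ t, g i ≠ 0 := fun i hi => (Finset.mem_filter.mp hi).2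
  have hrelt : ∑ i ∈ t, g i • padicLogAlgCl p (α i) = 0 := by
    rw [ht, Finset.sum_filter_of_ne]
    · exact hrel
    · intro i _ hne hgi
      rw [hgi, zero_smul] at hne
      exact hne rfl
  -- the ambient complete field `ℂ_p` and the embedding
  set ι₀ : PadicAlgCl p →+* ℂ_[p] := algebraMap (PadicAlgCl p) ℂ_[p] with hι₀
  have hι₀n : ∀ x, ‖ι₀ x‖ = ‖x‖ := fun x => PadicComplex.norm_extends p x
  have hι₀c : Continuous ι₀ := UniformSpace.Completion.continuous_coe (PadicAlgCl p)
  -- the logarithms in `ℂ_p`: `V i = log_p αᵢ` is the sum of the logarithmic series of `αᵢ`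
  set a : ι → ℂ_[p] := fun i => ι₀ (α i) with ha
  set V : ι → ℂ_[p] := fun i => ι₀ (padicLogAlgCl p (α i)) with hV
  have ha1 : ∀ i, ‖1 - a i‖ < 1 := fun i => by
    rw [ha]
    change ‖1 - ι₀ (α i)‖ < 1
    rw [← map_one ι₀, ← map_sub, hι₀n]
    exact h1 i
  have hVsum : ∀ i, ∑' n : ℕ, -((1 - a i) ^ (n + 1)) / (n + 1 : ℂ_[p]) = V i := by
    intro i
    have hs := (IwasawaLog.hasSum_log (h1 i)).map ι₀ hι₀c
    have hs' : HasSum (fun n : ℕ => -((1 - a i) ^ (n + 1)) / (n + 1 : ℂ_[p])) (V i) := by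
      refine hs.congr_fun fun n => ?_
      simp only [Function.comp_apply, map_div₀, map_neg, map_pow, map_sub, map_one, map_add,
        map_natCast, ha]
    exact hs'.tsum_eq
  -- linear independence over `ℚ` of the `V i`
  have hVli : LinearIndependent ℚ V := by
    have h := hli.map' ι₀.toRatAlgHom.toLinearMap (LinearMap.ker_eq_bot.mpr ι₀.injective)
    exact h
  -- local surjectivity of `exp` at `1`: the radius `δ`
  set ε : ℝ := (p : ℝ)⁻¹ * (p : ℝ)⁻¹ with hε
  have hε0 : 0 < ε := by positivity
  obtain ⟨δ, hδ0, hδ⟩ := PadicExp.exists_forall_exists_exp_eq (ℓ := p) (E := ℂ_[p]) hε0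
  -- the exponent `κ`
  have hK : ∀ i, ∃ K : ℕ, ∀ k ≥ K, ‖a i ^ (p ^ k) - 1‖ < δ := by
    intro i
    have h := Metric.tendsto_atTop.mp (tendsto_pow_prime_pow_sub_one (p := p) (ha1 i)) δ hδ0
    obtain ⟨K, hK⟩ := h
    exact ⟨K, fun k hk => by simpa [dist_zero_right] using hK k hk⟩
  choose K hK using hK
  set κ : ℕ := t.sup K with hκ
  have hκ' : ∀ i ∈ t, ‖a i ^ (p ^ κ) - 1‖ < δ := fun i hi => hK i κ (Finset.le_sup hi)
  -- the numbers `cᵢ` with `exp cᵢ = αᵢ^{p^κ}`, `‖cᵢ‖ < p⁻²`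
  have hc : ∀ i ∈ t, ∃ c : ℂ_[p], ‖c‖ < ε ∧ exp c = a i ^ (p ^ κ) := fun i hi => hδ _ (hκ' i hi)
  choose! c hcn hce using hc
  have hpinv_lt_one : (p : ℝ)⁻¹ < 1 := inv_lt_one_of_one_lt₀ (by exact_mod_cast hp.one_lt)
  have hεp : ε < (p : ℝ)⁻¹ := by
    rw [hε]
    calc (p : ℝ)⁻¹ * (p : ℝ)⁻¹ < (p : ℝ)⁻¹ * 1 := mul_lt_mul_of_pos_left hpinv_lt_one (by positivity)
      _ = (p : ℝ)⁻¹ := mul_one _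
  have hcn' : ∀ i ∈ t, ‖c i‖ < (p : ℝ)⁻¹ := fun i hi => (hcn i hi).trans hεp
  -- `cᵢ = p^κ V i`
  have hcV : ∀ i ∈ t, c i = ((p ^ κ : ℕ) : ℂ_[p]) * V i := by
    intro i hi
    have e1 := logSeries_exp (p := p) (E := ℂ_[p]) (hcn' i hi)
    rw [hce i hi] at e1
    rw [← e1, IwasawaLog.logSeries_pow (p := p) (ha1 i) (p ^ κ), hVsum i]
  -- the scaled logarithms `ℓ' i = cᵢ / p = (p^κ/p) V i`
  have hpK : (p : ℂ_[p]) ≠ 0 := by exact_mod_cast hp.ne_zero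
  set C : ℂ_[p] := ((p ^ κ : ℕ) : ℂ_[p]) / (p : ℂ_[p]) with hC
  have hC0 : C ≠ 0 := div_ne_zero (by exact_mod_cast (pow_pos hp.pos κ).ne') hpK
  set ℓ' : ι → ℂ_[p] := fun i => C * V i with hℓ'
  have hℓ'c : ∀ i ∈ t, ℓ' i = c i / p := by
    intro i hi
    rw [hℓ', hcV i hi, hC]
    change (((p ^ κ : ℕ) : ℂ_[p]) / (p : ℂ_[p])) * V i = _
    field_simp
  have hℓ'li : LinearIndependent ℚ ℓ' := by
    have h := hVli.map' (LinearMap.mulLeft ℚ C) (by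
      rw [LinearMap.ker_eq_bot]
      exact mul_right_injective₀ hC0)
    exact h
  have hnormp : ‖(p : ℂ_[p])‖ = (p : ℝ)⁻¹ := Setup.norm_prime (p := p) (𝕂 := ℂ_[p])
  have hℓ'n : ∀ i ∈ t, ‖ℓ' i‖ < (p : ℝ)⁻¹ := by
    intro i hi
    rw [hℓ'c i hi, norm_div, hnormp, div_lt_iff₀ (by positivity)]
    calc ‖c i‖ < ε := hcn i hi
      _ = (p : ℝ)⁻¹ * (p : ℝ)⁻¹ := hε
  have hℓ'exp : ∀ i ∈ t, exp ((p : ℂ_[p]) * ℓ' i) = a i ^ (p ^ κ) := by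
    intro i hi
    rw [hℓ'c i hi, mul_div_cancel₀ _ hpK, hce i hi]
  -- algebraicity
  have haalg : ∀ i, IsAlgebraic ℚ (a i) := fun i => (halg i).algHom ι₀.toRatAlgHom
  set b : ι → ℂ_[p] := fun i => ι₀ ((g i : PadicAlgCl p)) with hb
  have hbalg : ∀ i, IsAlgebraic ℚ (b i) := fun i =>
    ((mem_algebraicClosure_iff).1 (g i).2).algHom ι₀.toRatAlgHom
  have hb0 : ∀ i ∈ t, b i ≠ 0 := by
    intro i hi h0
    apply hgt i hi
    have h2 : ((g i : PadicAlgCl p)) = 0 := ι₀.injective (by rw [map_zero]; exact h0)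
    exact_mod_cast h2
  -- the relation in `ℂ_p`: `∑_{i ∈ t} bᵢ ℓ'ᵢ = 0`
  have hrelC : ∑ i ∈ t, b i * ℓ' i = 0 := by
    have h2 := congrArg ι₀ hrelt
    rw [map_sum, map_zero] at h2
    have h3 : ∑ i ∈ t, b i * V i = 0 := by
      rw [← h2]
      refine sum_congr rfl fun i _ => ?_
      rw [hb, hV, IntermediateField.smul_def, smul_eq_mul, map_mul]
    calc ∑ i ∈ t, b i * ℓ' i = C * ∑ i ∈ t, b i * V i := by
          rw [mul_sum]; exact sum_congr rfl fun i _ => by rw [hℓ']; ring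
      _ = 0 := by rw [h3, mul_zero]
  -- the largest coefficient `b i₀`
  obtain ⟨i₀, hi₀t, hmax⟩ := Finset.exists_max_image t (fun i => ‖b i‖) htne
  -- indexing: `Fin n ≃ t \ {i₀}`, `Fin (n+1) → ι` by `snoc _ i₀`
  set t' : Finset ι := t.erase i₀ with ht'
  set n : ℕ := t'.card with hn
  set f : Fin n → ι := fun r => ((t'.equivFin.symm r : t') : ι) with hf
  have hft' : ∀ r, f r ∈ t' := fun r => (t'.equivFin.symm r).2
  have hft : ∀ r, f r ∈ t := fun r => Finset.mem_of_mem_erase (hft' r)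
  have hfne : ∀ r, f r ≠ i₀ := fun r => Finset.ne_of_mem_erase (hft' r)
  have hfinj : Function.Injective f := by
    intro r r' h
    have h2 : t'.equivFin.symm r = t'.equivFin.symm r' := Subtype.ext h
    exact t'.equivFin.symm.injective h2
  set idx : Fin (n + 1) → ι := Fin.snoc f i₀ with hidx
  have hidx_inj : Function.Injective idx := snoc_injective hfinj hfne
  have hidx_t : ∀ j, idx j ∈ t := by
    intro j
    cases j using Fin.lastCases with
    | last => rw [hidx, Fin.snoc_last]; exact hi₀t
    | cast r => rw [hidx, Fin.snoc_castSucc]; exact hft r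
  have hidx_last : idx (Fin.last n) = i₀ := by rw [hidx, Fin.snoc_last]
  have hidx_cast : ∀ r : Fin n, idx (Fin.castSucc r) = f r := fun r => by
    rw [hidx, Fin.snoc_castSucc]
  -- the relation solved for `ℓ' i₀`
  set β : Fin n → ℂ_[p] := fun r => -b (f r) / b i₀ with hβ
  have hrelβ : ∑ r, β r * ℓ' (f r) = ℓ' i₀ := by
    have h2 := hrelC
    rw [← Finset.add_sum_erase t _ hi₀t, ← ht'] at h2
    -- `b i₀ ℓ' i₀ = -∑_{t'} bᵢ ℓ'ᵢ`
    have h3 : ∑ i ∈ t', b i * ℓ' i = ∑ r, b (f r) * ℓ' (f r) := by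
      rw [← Finset.sum_coe_sort t']
      exact (Equiv.sum_comp t'.equivFin.symm (fun x : t' => b x * ℓ' x)).symm
    have hb0' := hb0 i₀ hi₀t
    have e : ∀ r, β r * ℓ' (f r) = (-(b (f r) * ℓ' (f r))) / b i₀ := fun r => by
      simp only [hβ]; ring
    rw [Finset.sum_congr rfl fun r _ => e r, ← Finset.sum_div, Finset.sum_neg_distrib, ← h3,
      div_eq_iff hb0']
    linear_combination -h2
  -- the `Setup`
  have S : Setup p ℂ_[p] :=
    { n := n
      ℓ := fun j => ℓ' (idx j)
      β := β
      norm_ℓ := fun j => hℓ'n _ (hidx_t j)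
      norm_β := fun r => by
        rw [hβ]
        change ‖-b (f r) / b i₀‖ ≤ 1
        rw [norm_div, norm_neg]
        exact div_le_one_of_le₀ (hmax _ (hft r)) (norm_nonneg _)
      linearIndependent := hℓ'li.comp idx hidx_inj
      isAlgebraic_exp := fun j => by
        rw [hℓ'exp _ (hidx_t j)]
        exact (haalg _).pow _
      isAlgebraic_β := fun r => by
        have h1 : b (f r) ∈ algebraicClosure ℚ ℂ_[p] := (mem_algebraicClosure_iff).2 (hbalg _)
        have h2 : b i₀ ∈ algebraicClosure ℚ ℂ_[p] := (mem_algebraicClosure_iff).2 (hbalg _)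
        exact (mem_algebraicClosure_iff).1 (div_mem (neg_mem h1) h2)
      rel := by
        simp only [hidx_cast, hidx_last]
        exact hrelβ }
  exact S.false_of_setup

end Literature.NumberTheory.Transcendental

end
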